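import Literature.MathematicalPhysics.QuantumFieldTheory.Balaban1983to89.B8Prop6DentedCubeMemberScalarGammaOfNamedFactsGPrecompRec
import Literature.MathematicalPhysics.QuantumFieldTheory.Balaban1983to89.B8Prop6DentedCubeMemberScalarGammaSU25Rec

/-!
# `Balaban1983to89.B8Prop6DentedCubeMemberScalarGammaSU25PrecompRec` — [Balaban1985RegularSpaces] PROPOSITION 6 (p. 99), (1.135)–(1.138) ∕ [Balaban1985Variational] (148)–(153),
# AT EVERY DENTED CENTRED CUBE MEMBER OF PRINT's BIG-BLOCK SUB-LATTICE FOR `G = SU(N)` (`N ≤ 25`), THE RECORD's SYMMETRISED CENTRED block averaging (0.4) of [Balaban1987RG1],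
# **FOR THE PRE-COMPOSED THEOREM-4 INPUT `(U₀″)^{h}`** (`h` `SU(N)`-valued, constant on the block towers under the dented cells, oscillation `ω`) — THE PRE-COMPOSED `SU(N)`
# RECORD CROWN, UNCONDITIONALLY: the pre-composed twin of ✓`B8Prop6DentedCubeMemberScalarGammaSU25Rec`; the last item of (B′-4)·4 of the plan's road (B′) (pen dag-n05-e g42)

statement-level skeleton of published theorems with citation tags; proofs where landed; nothing here is a claim about the Yang–Mills mass gap

T. Bałaban, *Spaces of regular gauge field configurations on a lattice and gauge fixing conditions*, Commun. Math. Phys. **99** (1985) 75–102 `[Balaban1985RegularSpaces]` ("[6]"):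
Prop. 6 (1.135)–(1.138) p. 99, p. 98, p. 76, (1.17) p. 78, (1.29) p. 81; T. Bałaban, *The variational problem and background fields in renormalization group method for lattice gauge
theories*, Commun. Math. Phys. **102** (1985) 277–309 `[Balaban1985Variational]` ("[15]"): (148)–(153) p. 301; T. Bałaban, *Averaging operations for lattice gauge theories*,
Commun. Math. Phys. **98** (1985) 17–51 `[Balaban1985Averaging]` ("[3]"): (11) p. 19, p. 18, p. 20, (20)–(23) p. 21, (42)–(43) pp. 23–24; T. Bałaban, *Propagators for lattice gauge
theories in a background field*, Commun. Math. Phys. **99** (1985) 389–434 `[Balaban1985BackgroundPropagators]` ("[4]"): (3.14)–(3.15) p. 393, Thms 3.1–3.3 pp. 398–399;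
T. Bałaban, *Renormalization group approach to lattice gauge field theories. I*, Commun. Math. Phys. **109** (1987) 249–301 `[Balaban1987RG1]` ("[I]"): (0.3)–(0.4), (0.6)
pp. 252–253.  STATUS: published, refereed.

CITATION HEADER (lean-in-tree rule).  Cell `pub-ymgap` (HUMAN RULING D-0062, Track A), «N05-REC» road, ROAD (B′) = director-ym №310–№312a branch (ii) case (β) («axiality-
preserving block-constant pre-composition of the Theorem-4 input `U₀″ ↦ (U₀″)^h`»; licence line: variant, our proof — NOT a printed clause); LEAD PEN dag-n05-e g42.  WHAT IS
CERTIFIED.  ★★★ `gaugedBoundB8DZ_dentedMember_precomposed_scalar_γ_holds_specialUnitary_of_le` (`d ≥ 2`, odd `L = 2s+1 ≥ 5`, `N ≤ 25`): the original's statement (chair #10677,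
✓p739612) with the pre-composition binders of #10822∕#10823 (`h` `SU(N)`-valued), print's threshold `7dL²Mα₀ + ω ≤ c₁`, and the pre-composed crown body (F2 §3 ✓p747495) as
conclusion; ONE `exact` into F7 §4 `gaugedBoundB8DZ_dentedMember_precomposed_scalar_γ_holds_mem` with `τ := trCLM`, `G := specialUnitaryUnits (Fin N)`, `H := slUnits N` and the
joint J-SU inhabitants of the original BY NAME.  WHY.  With `h := X` on the tower under `y`, `X := R̄ʲ(g_sr)(y)` (the sym∕radial transport of the junction), the junction's row 9′
argument `g_sr·h⁻¹·u` has `R̄ʲ(g_sr·X⁻¹)(y) = 1` EXACTLY ((B′-5) `rbar_one_mul_blockConstant_eq_one`) and the cross term with `u` is second order ((B′-5)′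
`rbar_one_mul_sub_mul_le_tower`) — so this crown + (B′-5)∕(B′-5)′ is what a pre-composed `RecordCrownSU`-type bridge of dag-n07-w3 ∕ the φ-b₂ row 9′ of dag-n07-e's
`HThm4RecSym152Phi` consume (plan road (B′), ROAD-BPRIME.md §2).  Kind «kernel-checked proof», ONE theorem: no `def`, no `… : Prop` fact, no `instance` (the `CStarAlgebra (Matrix …)`
structure is a `letI` inside statement and proof, as in the original), no `notation`, no existing module modified.  `--supports stmt-QuantumFields-20541` (K0⁷-keyed, COUNT-NEUTRAL).

HONEST SCOPE.  Instantiation only; the analytic content is that of the record chain re-run at the datum `(1, (U₀″)^h)` (Theorem 4 ∕ Prop. 5 ∕ Sect. E ∕ [4] Thms 3.1–3.3 of record,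
dag-n05-cov's Cov facts); NO new estimate; UNCONDITIONAL as a Literature theorem — STILL NOT a node discharge: the junction's choice of `X` and the cross-term bound ψ₂ live on the
N07 side; `HThm4Rec*` UNDISCHARGED; N05 ∕ N07 NOT discharged; K0⁷'s stubs untouched; COUNT of record unmoved; one finite 𝕋⁴ programme at fixed ε, `G = SU(2)` of record, Bałaban
AS PRINTED; nothing continuum ∕ ℝ⁴ ∕ OS ∕ mass-gap ∕ Clay.  No `sorry`, no `def`.
-/

noncomputable section

namespace Literature.MathematicalPhysics.QuantumFieldTheory.Balaban1983to89.B8Prop6DentedCubeMemberScalarGammaSU25PrecompRec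

open scoped Matrix
open MatrixLog B7Prop1Explicit B7Prop2Explicit B7Prop1Local B7Eq92Concrete
open BlockAveragingZd (ctrShift avgIterZ)
open B7SectEFLinearisationRec (logCovIterZ)
open B8Ineq132 (covDerivFwd InAk)
open B8Eq140Level (SideTouches)
open B8Eq143PlaqExpansion (pdiv)
open B8Eq146AExpansion (iEta plaqCovDeriv)
open B8ScaledSupNorm (bondNorm msup)
open B8Eq184Proof (gaugeExp cfgExp)
open B8Eq138LandauZd (covLap logCfg)
open B8Eq138LandauZdRec (IsLandau138WZ)
open B8Eq119TwistedAxialRec (Restr129Z)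
open B8Eq131Cubes (tLo tHi)
open B8Eq131CubesRec (bLoZ bHiZ)
open B8Ineq130Rec (tlo thi)
open MatrixLog (mlog)
open NormedSpace
open Node00 (CubeB8DZ)
open Literature.MathematicalPhysics.QuantumLattice (blockMap)
open B8Prop6DentedCubeMemberScalarGammaOfNamedFactsGPrecompRec (gaugedBoundB8DZ_dentedMember_precomposed_scalar_γ_holds_mem)
open B7AvgGaugeCovariance (uLev)
open B8Eq119TwistedAxialRec (UnderZ)

export B7Prop1Explicit (Site)

variable {d : ℕ}

/-! ## §1  AT `𝔸 = M_N(ℂ)`, `G = SU(N)` (`N ≤ 25`), `H = SL(N, ℂ)`, `τ = tr`: the pre-composed crown with a special-unitary gauge transformation -/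

section SpecialUnitary


open scoped Matrix.Norms.L2Operator
open B7Prop2SpecialUnitary (specialUnitaryUnits specialUnitaryUnits_le_unitaryUnits)
open B13Inv214OrbitSUN (slUnits)
open B8SpecialUnitaryTrace (trCLM trCLM_mul_comm gaugeExp_mem_specialUnitaryUnits)
open B8SpecialLinearTrace (specialUnitaryUnits_le_slUnits trCLM_mlog_eq_zero_of_mem_slUnits expUnit_mem_slUnits)
open B7Prop2SpecialUnitarySharpRec (avgClosedZ_specialUnitary_fin_of_le)

open Classical in
/-- ★★★ (PRE-COMPOSED twin of ✓`B8Prop6DentedCubeMemberScalarGammaSU25Rec.gaugedBoundB8DZ_dentedMember_scalar_γ_holds_specialUnitary_of_le`.) **PROPOSITION 6 (p. 99) ∕ [15]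
(148)–(153) AT EVERY DENTED CENTRED CUBE MEMBER OF PRINT's BIG-BLOCK SUB-LATTICE FOR THE PRE-COMPOSED THEOREM-4 INPUT `(U₀″)^{h}`, WITH A SPECIAL-UNITARY GAUGE TRANSFORMATION —
`G = SU(N)` ([Balaban1985Averaging] p. 20's Lie subgroup `G ≤ U(N)`, the case of record), THE RECORD's CENTRED AVERAGING, `d ≥ 2`, odd `L = 2s+1 ≥ 5`, `N ≤ 25` —
UNCONDITIONALLY**: F7 §4 `gaugedBoundB8DZ_dentedMember_precomposed_scalar_γ_holds_mem` at `𝔸 := M_N(ℂ)`, `τ := tr` (`B8SpecialUnitaryTrace.trCLM`), `G := SU(N)`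
(`B7Prop2SpecialUnitary.specialUnitaryUnits`), `H := SL(N, ℂ)` (`B13Inv214OrbitSUN.slUnits`), the joint J-SU data inhabited exactly as in the original ((H2)
`trCLM_mlog_eq_zero_of_mem_slUnits` (`N ≤ 25`), (H3) `expUnit_mem_slUnits`, `specialUnitaryUnits_le_slUnits`, `avgClosedZ_specialUnitary_fin_of_le`, `gaugeExp_mem_specialUnitaryUnits`):
there are `B₀ ≥ 1`, `c₁ > 0` and thresholds `ρ₀, M₀, N₀, R₀` such that for every `η > 0`, every dented RECORD cube datum `c : CubeB8DZ d L K Ω` on print's p. 98 sub-lattice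
above threshold with the anchored dent premise, every `SU(N)`-VALUED `U₀ ∈ 𝔄_K({Ω_j}, α₀)`, every `SU(N)`-VALUED `h` CONSTANT `= X(j, y)` on the block tower under every dented cell
`y ∈ Λ′_j` (`1 ≤ j ≤ k`) with oscillation `≤ ω` (`0 ≤ ω`) across the (1.35) bonds and the level-0 collar, with `7dL²·c.M·α₀ + ω ≤ c₁`: the twelve clauses of the PRE-COMPOSED
CROWN BODY with `r = 5dLB₀·(7dL²·c.M·α₀ + ω)` — `u` `SU(N)`-valued, `= 1` off `Ω′₀`, (1.29)∕(152) «ū_j = 1 on Λ′_j» EXACT for `u`, the Landau gauge of record (1.138)∕(153) and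
the (1.62)-data of `((U₀″)^h)^{u⁻¹} = c.fixed U₀ (h⁻¹u)`, `w′ = v⁻¹h⁻¹u` `SU(N)`-VALUED with (1.135)′ `U₀^{w′⁻¹} = ((U₀″)^h)^{u⁻¹}` on `□̃`, the three norm members of (1.136), and
(1.137)'s identity `Q_k(iηA) = log \overline{(U₀′)^{h}}ᵏ` on the bonds of `□^{(k)}` over `Ω_k`.  Item (B′-4)·4 of the plan's road (B′) (director-ym №310–№312a branch (ii)
case (β); licence: variant, our proof); the premise shape a pre-composed `RecordCrownSU`-type bridge at the N05 → N07 junction reads.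
[cite: Balaban1985RegularSpaces, Prop. 6 (1.135)–(1.138) p.99, p.98, p.76, (1.17) p.78, (1.29) p.81; Balaban1985Variational, (148)–(153) p.301; Balaban1985Averaging, p.18, (11) p.19, p.20, (20)–(23) p.21, (42)–(43) pp.23–24; Balaban1985BackgroundPropagators, (3.14)–(3.15) p.393, Thms 3.1–3.3 pp.398–399; Balaban1987RG1, (0.3)–(0.4) pp.252–253, (0.6) p.253] -/
theorem gaugedBoundB8DZ_dentedMember_precomposed_scalar_γ_holds_specialUnitary_of_le (hd2 : 2 ≤ d) {L sL : ℕ} (hLs : L = 2 * sL + 1) (hs2 : 2 ≤ sL) {N : ℕ} [NeZero N] (hN : N ≤ 25) :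
    letI : CStarAlgebra (Matrix (Fin N) (Fin N) ℂ) := {}
    ∃ B₀ c₁ ρ₀ M₀ : ℝ, ∃ N₀ R₀ : ℕ, 1 ≤ B₀ ∧ 0 < c₁ ∧ ∀ (η : ℝ), 0 < η → ∀ {K : ℕ} {Ω : ℕ → Set (Site d)} (c : CubeB8DZ d L K Ω),
      ∀ (s R : ℕ), 3 ≤ L ^ s → M₀ ≤ (L : ℝ) ^ (s + 1) → L ^ (s + 1) ∣ c.ρ → L ^ (s + 1) ∣ c.M → R * L ^ (s + 1) ≤ c.ρ → 2 * L ≤ R →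
        R₀ ≤ R → N₀ + 1 ≤ R * L ^ (s + 1) → ρ₀ ≤ (c.ρ : ℝ) →
      (∀ x y : Site d,
          blockMap (L ^ (s + 1) * L ^ c.k) (x - fun i => (L : ℤ) ^ c.k * (c.a i - c.ρ) - (ctrShift L c.k : ℤ)) =
            blockMap (L ^ (s + 1) * L ^ c.k) (y - fun i => (L : ℤ) ^ c.k * (c.a i - c.ρ) - (ctrShift L c.k : ℤ)) → x ∈ Ω c.k → y ∈ Ω c.k) →
      ∀ (U₀ : Site d → Fin d → (Matrix (Fin N) (Fin N) ℂ)ˣ), (∀ x κ, U₀ x κ ∈ specialUnitaryUnits (Fin N)) → ∀ (α₀ : ℝ), 0 < α₀ → InAk L K η α₀ Ω U₀ →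
      -- the pre-composition `h`: `SU(N)`-valued, constant `= X(j, y)` on the block tower under every dented cell, oscillation `ω`
      ∀ (h : Site d → (Matrix (Fin N) (Fin N) ℂ)ˣ), (∀ x, h x ∈ specialUnitaryUnits (Fin N)) → ∀ (X : ℕ → Site d → (Matrix (Fin N) (Fin N) ℂ)ˣ),
      (∀ j, 1 ≤ j → j ≤ c.k → ∀ y ∈ c.lamS j, ∀ x, UnderZ L j y x → h x = X j y) → ∀ (ω : ℝ), 0 ≤ ω →
      (∀ j, j ≤ c.k → ∀ (z : Site d) (μ : Fin d),
        (∀ x, InBox (fun i => (L : ℤ) ^ j * z i - (ctrShift L j : ℤ)) (fun i => (L : ℤ) ^ j * z i + (ctrShift L j : ℤ) + if i = μ then (L : ℤ) ^ j else 0) x →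
          x ∈ c.sq (j - 1)) → ‖((uLev L h j z : (Matrix (Fin N) (Fin N) ℂ)ˣ) : Matrix (Fin N) (Fin N) ℂ) - ((uLev L h j (z + e μ) : (Matrix (Fin N) (Fin N) ℂ)ˣ) : Matrix (Fin N) (Fin N) ℂ)‖ ≤ ω) →
      (∀ b ∈ {b : Site d × Fin d | SideTouches (c.sq 0) b.1 b.2},
        ‖((h b.1 : (Matrix (Fin N) (Fin N) ℂ)ˣ) : Matrix (Fin N) (Fin N) ℂ) - ((h (b.1 + e b.2) : (Matrix (Fin N) (Fin N) ℂ)ˣ) : Matrix (Fin N) (Fin N) ℂ)‖ ≤ ω) →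
      7 * d * (L : ℝ) ^ 2 * c.M * α₀ + ω ≤ c₁ →
      ∃ u : Site d → (Matrix (Fin N) (Fin N) ℂ)ˣ, (∀ x, u x ∈ specialUnitaryUnits (Fin N)) ∧ (∀ x, x ∉ c.sq 0 → u x = 1) ∧
        Restr129Z L c.k c.lamS (1 : Site d → Fin d → (Matrix (Fin N) (Fin N) ℂ)ˣ) u ∧
        IsLandau138WZ L c.k η (c.sq 0) c.lamS (1 : Site d → Fin d → (Matrix (Fin N) (Fin N) ℂ)ˣ) (c.fixed U₀ (h⁻¹ * u)) ∧
        (∀ j, j ≤ c.k → ∀ b ∈ {b : Site d × Fin d | SideTouches (c.sq j) b.1 b.2},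
          c.fixed U₀ (h⁻¹ * u) b.1 b.2 = cfgExp η (logCfg η (c.fixed U₀ (h⁻¹ * u))) b.1 b.2 ∧ IsSelfAdjoint (logCfg η (c.fixed U₀ (h⁻¹ * u)) b.1 b.2) ∧
            ‖logCfg η (c.fixed U₀ (h⁻¹ * u)) b.1 b.2‖ ≤ (5 * (d : ℝ) * L * B₀ * (7 * d * (L : ℝ) ^ 2 * c.M * α₀ + ω)) * ((L : ℝ) ^ j * η)⁻¹) ∧
        (∀ x, ((c.vfix U₀)⁻¹ * (h⁻¹ * u)) x ∈ specialUnitaryUnits (Fin N)) ∧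
        AgreeOn (tlo L (tLo c.a c.ρ) c.k) (thi L (tHi c.a c.M c.ρ) c.k) (gaugeAct ((c.vfix U₀)⁻¹ * (h⁻¹ * u))⁻¹ U₀) (c.fixed U₀ (h⁻¹ * u)) ∧
        msup L c.k η (-(2 : ℝ)) (fun j (t : Fin d × Fin d × Site d) => SideTouches (c.sq j) t.2.2 t.2.1)
            (fun t => covDerivFwd η (1 : Site d → Fin d → (Matrix (Fin N) (Fin N) ℂ)ˣ) t.1 (fun z => c.expo η U₀ (h⁻¹ * u) z t.2.1) t.2.2) ≤ (5 * (d : ℝ) * L * B₀ * (7 * d * (L : ℝ) ^ 2 * c.M * α₀ + ω)) ∧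
        bondNorm L c.k η (-(3 : ℝ)) c.sq
            (fun x μ => pdiv η (1 : Site d → Fin d → (Matrix (Fin N) (Fin N) ℂ)ˣ) (plaqCovDeriv η (1 : Site d → Fin d → (Matrix (Fin N) (Fin N) ℂ)ˣ) (c.expo η U₀ (h⁻¹ * u))) μ x) ≤ (5 * (d : ℝ) * L * B₀ * (7 * d * (L : ℝ) ^ 2 * c.M * α₀ + ω)) ∧
        bondNorm L c.k η (-(3 : ℝ)) c.sq (fun x μ => covLap η (1 : Site d → Fin d → (Matrix (Fin N) (Fin N) ℂ)ˣ) (fun z => c.expo η U₀ (h⁻¹ * u) z μ) x) ≤ (5 * (d : ℝ) * L * B₀ * (7 * d * (L : ℝ) ^ 2 * c.M * α₀ + ω)) ∧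
        (∀ (x : Site d) (μ : Fin d), bLoZ L c.a 0 0 ≤ x → x + e μ ≤ bHiZ L c.a c.M 0 0 → c.inTop x → c.inTop (x + e μ) →
          logCovIterZ L (1 : Site d → Fin d → (Matrix (Fin N) (Fin N) ℂ)ˣ) (iEta η (c.expo η U₀ (h⁻¹ * u))) c.k x μ = mlog ((avgIterZ L (gaugeAct h (c.axial U₀)) c.k x μ : (Matrix (Fin N) (Fin N) ℂ)ˣ) : Matrix (Fin N) (Fin N) ℂ)) := by
  letI : CStarAlgebra (Matrix (Fin N) (Fin N) ℂ) := {}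
  exact gaugedBoundB8DZ_dentedMember_precomposed_scalar_γ_holds_mem (𝔸 := Matrix (Fin N) (Fin N) ℂ) (trCLM (Fin N)) trCLM_mul_comm hd2 hLs hs2
    (G := specialUnitaryUnits (Fin N)) (H := slUnits N)
    (fun g hg hs => trCLM_mlog_eq_zero_of_mem_slUnits hN hg hs) (fun S hS => expUnit_mem_slUnits hS)
    (avgClosedZ_specialUnitary_fin_of_le d L hN) specialUnitaryUnits_le_slUnits specialUnitaryUnits_le_unitaryUnits
    (fun lam hsa htr x => gaugeExp_mem_specialUnitaryUnits hsa htr x)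

#print axioms gaugedBoundB8DZ_dentedMember_precomposed_scalar_γ_holds_specialUnitary_of_le

end SpecialUnitary

end Literature.MathematicalPhysics.QuantumFieldTheory.Balaban1983to89.B8Prop6DentedCubeMemberScalarGammaSU25PrecompRec

end
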